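import Summits.QuantumAdvantage.AdviceFreeQNC0.AugmentedCodePatterns
import HarnessLib

/-!
# Cell qa-qnc0 — `stub_coset`: tensor robustness of `C⁺ ⊗ C⁺` plus elimination hardness bound the cross-team game

The stub `stub_coset : TRPlus → ElimHard → CrossTeamHardPolylog` of planner qa-qnc0-p2's line
`tensor` of the route crux `RingToElim`, PROVED for all block lengths with the three bodies verbatim
(`crossTeamHard_of_trplus_of_elimHard`; ROUND-1 §9.26–9.27):

* the LOST cells are `Z = X + Y` with `X` = member 1's column win patterns (columns in `C_L(d)`) and
  `Y` = member 0's row fail patterns (rows in `𝟙 + C_{L'}(d)`) — the three-mode XOR law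
  (`crossWin_iff_ne`), so `|Z| = 2^{L+L'} − crossWinCount` (`hw_xorM_eq_agree`);
* `TRPlus` (slack `ε = η₀²/2`) gives `W` with rows and columns in `C⁺` and `|X+W| ≤ K|Z| + ε4^…`;
* parity functionals `φ` (block `L`) and `ψ` (block `L'`) (`exists_parity`, from `𝟙 ∉ C` under
  `ElimHard`): the column parities `pcol = φ ∘ col(W)` lie in `C⁺_{L'}`, the row parities
  `prow = ψ ∘ row(W)` in `C⁺_L`, and `ψ(pcol) = φ(prow) =: ε₀` (`functional_of_cols_mem`);
* odd columns of `X + W` and even rows of `W + Y` are words of odd cosets, hence heavy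
  (`odd_coset_heavy`): `#{pcol = 1}·η₀2^L ≤ |X+W|`, `#{prow = 0}·η₀2^{L'} ≤ |X+W| + |Z|`;
* `ε₀ = 0 ⇒ prow + 𝟙` odd `⇒ #{prow = 0} ≥ η₀2^L`; `ε₀ = 1 ⇒ pcol` odd `⇒ #{pcol = 1} ≥ η₀2^{L'}`;
  either way `η₀² 2^{L+L'} ≤ (K+1)|Z| + ε 2^{L+L'}`, so `θ = 1 − η₀²/(2(K+1))`.
-/

namespace Summit.QuantumAdvantage.AdviceFreeQNC0

open Finset Literature.Computability.MetaComplexity Literature.Computability.MetaComplexity.Smolensky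

variable {L L' : ℕ}

/-! ### Counting cells by rows and by columns -/

/-- Cells counted row by row. -/
theorem hw_eq_sum_rows (M : (Fin L → Bool) → (Fin L' → Bool) → Bool) :
    hw M = ∑ u : Fin L → Bool, (univ.filter fun v : Fin L' → Bool => M u v = true).card := by
  unfold hw
  rw [card_filter, ← Finset.univ_product_univ, Finset.sum_product]
  exact Finset.sum_congr rfl fun u _ => by rw [card_filter]

/-- Cells counted column by column. -/
theorem hw_eq_sum_cols (M : (Fin L → Bool) → (Fin L' → Bool) → Bool) :
    hw M = ∑ v : Fin L' → Bool, (univ.filter fun u : Fin L → Bool => M u v = true).card := by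
  unfold hw
  rw [card_filter, ← Finset.univ_product_univ, Finset.sum_product_right]
  exact Finset.sum_congr rfl fun v _ => by rw [card_filter]

/-- In `𝔽₂`, `[p] + [q] = 1 ↔ p ≠ q`. -/
theorem indZ_add_eq_one_iff {k : ℕ} (p q : (Fin k → Bool) → Bool) (x : Fin k → Bool) :
    (indZ p + indZ q) x = 1 ↔ p x ≠ q x := by
  simp only [Pi.add_apply, indZ]
  have key : ∀ a b : Bool, ((if a = true then (1 : ZMod 2) else 0) + (if b = true then 1 else 0) = 1) ↔
      a ≠ b := by decide
  exact key (p x) (q x)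

/-- In `𝔽₂`, `([p] + 1) = 1 ↔ p = false`. -/
theorem add_one_eq_one_iff (x : ZMod 2) : x + 1 = 1 ↔ x = 0 := by
  revert x; decide

/-! ### The lost cells -/

/-- **The lost cells are the XOR of member 1's column win patterns and member 0's row fail
patterns**, and they number `2^{L+L'} − crossWinCount`. -/
theorem hw_xorM_eq_agree (c : ℕ) (F₀ : (Fin L → Bool) → (Fin L' → Bool) → T4)
    (F₁ : (Fin L' → Bool) → (Fin L → Bool) → T4) :
    hw (xorM (fun u v => win1 c F₁ u v)
        (fun u v => elimFail (2 * (c + wt u)) (fun v => (F₀ u v).1) (fun v => (F₀ u v).2) v)) =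
      agreeCountR (win1 c F₁) (win0 c F₀) := by
  unfold hw agreeCountR xorM win0
  congr 1
  ext p
  simp only [mem_filter, mem_univ, true_and]
  cases win1 c F₁ p.1 p.2 <;>
    cases elimFail (2 * (c + wt p.1)) (fun v => (F₀ p.1 v).1) (fun v => (F₀ p.1 v).2) p.2 <;> decide

/-! ### The stub -/

/-- **`stub_coset`, all `L, L'`** (bodies of `TRPlus`, `ElimHard`, `CrossTeamHardPolylog` verbatim):
tensor robustness of the augmented elimination codes with additive slack, together with elimination
hardness, bounds the winning probability of the cross team away from `1`. -/
theorem crossTeamHard_of_trplus_of_elimHard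
    (hT : ∀ ε : ℝ, 0 < ε → ∃ K : ℝ, 0 < K ∧ ∀ C : ℕ, ∃ L₀ : ℕ, ∀ L L' : ℕ, L₀ ≤ L → L₀ ≤ L' →
      ∀ d : ℕ, d ≤ (Nat.log 2 (min L L')) ^ C →
        ∀ X Y : (Fin L → Bool) → (Fin L' → Bool) → Bool, ColsIn d X → RowsIn d Y →
          ∃ W : (Fin L → Bool) → (Fin L' → Bool) → Bool, ColsIn d W ∧ RowsIn d W ∧
            (hw (xorM X W) : ℝ) ≤ K * hw (xorM X Y) + ε * (2 : ℝ) ^ (L + L'))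
    (hE : ∃ η₀ : ℝ, 0 < η₀ ∧ ∀ C : ℕ, ∃ n₀ : ℕ, ∀ n ≥ n₀, ∀ a b : CubeFn (ZMod 2) n,
      a ∈ lowDeg (ZMod 2) n ((Nat.log 2 n) ^ C) → b ∈ lowDeg (ZMod 2) n ((Nat.log 2 n) ^ C) →
        ∀ dec : ZMod 2 → ZMod 2 → ℕ,
          η₀ * (2 : ℝ) ^ n ≤ ((univ.filter fun u : Fin n → Bool =>
            dec (a u) (b u) % 3 = Hegedus.wt u % 3).card : ℝ)) :
    ∃ θ : ℝ, θ < 1 ∧ ∀ C : ℕ, ∃ L₀ : ℕ, ∀ L L' : ℕ, L₀ ≤ L → L₀ ≤ L' →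
      ∀ c : ℕ, ∀ F₀ : (Fin L → Bool) → (Fin L' → Bool) → T4,
        ∀ F₁ : (Fin L' → Bool) → (Fin L → Bool) → T4,
          CrossDeg ((Nat.log 2 (min L L')) ^ C) F₀ → CrossDeg ((Nat.log 2 (min L L')) ^ C) F₁ →
            (crossWinCount c F₀ F₁ : ℝ) ≤ θ * (2 : ℝ) ^ (L + L') := by
  obtain ⟨η₀, hη₀, hEl⟩ := hE
  obtain ⟨K, hK, hTK⟩ := hT (η₀ ^ 2 / 2) (by positivity)
  refine ⟨1 - η₀ ^ 2 / (2 * (K + 1)), by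
    have : 0 < η₀ ^ 2 / (2 * (K + 1)) := by positivity
    linarith, fun C => ?_⟩
  obtain ⟨L₁, hL₁⟩ := hTK C
  obtain ⟨n₀, hn₀⟩ := hEl C
  refine ⟨max L₁ n₀, fun L L' hL hL' c F₀ F₁ hF₀ hF₁ => ?_⟩
  set d := (Nat.log 2 (min L L')) ^ C with hd
  have hdL : d ≤ (Nat.log 2 L) ^ C := Nat.pow_le_pow_left (Nat.log_mono_right (min_le_left L L')) C
  have hdL' : d ≤ (Nat.log 2 L') ^ C := Nat.pow_le_pow_left (Nat.log_mono_right (min_le_right L L')) C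
  have hLn : n₀ ≤ L := le_trans (le_max_right _ _) hL
  have hL'n : n₀ ≤ L' := le_trans (le_max_right _ _) hL'
  -- the two matrices
  set X : (Fin L → Bool) → (Fin L' → Bool) → Bool := fun u v => win1 c F₁ u v with hX
  set Y : (Fin L → Bool) → (Fin L' → Bool) → Bool :=
    fun u v => elimFail (2 * (c + wt u)) (fun v => (F₀ u v).1) (fun v => (F₀ u v).2) v with hY
  have hXcols : ColsIn d X := fun v => by
    show InCPlus d (fun u => win1 c F₁ u v)
    unfold win1
    exact inCPlus_win (c + wt v) (hasDeg_xor (hF₁ v).1 (hF₁ v).2) (hF₁ v).2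
  have hYrows : RowsIn d Y := fun u => by
    show InCPlus d (fun v => elimFail (2 * (c + wt u)) (fun v => (F₀ u v).1) (fun v => (F₀ u v).2) v)
    exact inCPlus_fail (2 * (c + wt u)) (hF₀ u).1 (hF₀ u).2
  -- tensor robustness
  obtain ⟨W, hWc, hWr, hTR⟩ := hL₁ L L' (le_trans (le_max_left _ _) hL) (le_trans (le_max_left _ _) hL')
    d le_rfl X Y hXcols hYrows
  -- the 𝔽₂ model of `W`, its row and column parities
  set Wz : (Fin L → Bool) → CubeFn (ZMod 2) L' := fun u => indZ (fun v => W u v) with hWz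
  have hrowW : ∀ u, Wz u ∈ cplus L' d := fun u => indZ_mem_cplus_of_inCPlus (hWr u)
  have hcolW : ∀ v, (fun u => Wz u v) ∈ cplus L d := fun v => indZ_mem_cplus_of_inCPlus (hWc v)
  obtain ⟨φ, hφ0, hφ1⟩ := exists_parity (one_notMem_code hη₀ hn₀ hLn hdL)
  obtain ⟨ψ, hψ0, hψ1⟩ := exists_parity (one_notMem_code hη₀ hn₀ hL'n hdL')
  set pcol : CubeFn (ZMod 2) L' := fun v => φ (fun u => Wz u v) with hpcol
  set prow : CubeFn (ZMod 2) L := fun u => ψ (Wz u) with hprow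
  have hpcol_mem : pcol ∈ cplus L' d := functional_of_cols_mem (cplus L' d) Wz hrowW φ
  have hprow_mem : prow ∈ cplus L d :=
    functional_of_cols_mem (cplus L d) (fun v u => Wz u v) hcolW ψ
  have heps : ψ pcol = φ prow := by
    have h1 : pcol = ∑ u : Fin L → Bool, φ (Pi.single u 1) • Wz u := by
      funext v
      rw [hpcol]
      simp only
      rw [functional_col_eq_sum Wz φ v, Finset.sum_apply]
      simp only [Pi.smul_apply, smul_eq_mul]
      exact Finset.sum_congr rfl fun u _ => mul_comm _ _
    rw [h1, map_sum]
    simp only [map_smul, smul_eq_mul]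
    rw [functional_col_eq_sum (fun u (_ : Fin L → Bool) => prow u) φ (fun _ => false)]
    exact Finset.sum_congr rfl fun u _ => mul_comm _ _
  -- (i) odd columns of `X + W` are heavy
  set S₁ := univ.filter fun v : Fin L' → Bool => pcol v = 1 with hS₁
  have hcolcount : (S₁.card : ℝ) * (η₀ * 2 ^ L) ≤ (hw (xorM X W) : ℝ) := by
    have hper : ∀ v ∈ S₁, η₀ * (2 : ℝ) ^ L ≤
        ((univ.filter fun u : Fin L → Bool => xorM X W u v = true).card : ℝ) := by
      intro v hv
      have hv1 : pcol v = 1 := (Finset.mem_filter.1 hv).2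
      have hW1 : (fun u => Wz u v) + 1 ∈ code L d := (parity_one_iff hφ0 hφ1 (hcolW v)).1 hv1
      have hXv : indZ (fun u => X u v) ∈ code L d := by
        show indZ (fun u => win1 c F₁ u v) ∈ code L d
        unfold win1
        exact indZ_win_mem_code (c + wt v) (hasDeg_xor (hF₁ v).1 (hF₁ v).2) (hF₁ v).2
      have hsum : (indZ (fun u => X u v) + indZ (fun u => W u v)) + 1 ∈ code L d := by
        rw [add_assoc]
        exact Submodule.add_mem _ hXv hW1
      refine le_trans (odd_coset_heavy hn₀ hLn hdL hsum) ?_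
      exact_mod_cast card_le_card fun u hu => by
        rw [mem_filter] at hu ⊢
        refine ⟨mem_univ _, ?_⟩
        have := (indZ_add_eq_one_iff _ _ u).1 hu.2
        show xor (X u v) (W u v) = true
        revert this
        cases X u v <;> cases W u v <;> decide
    calc (S₁.card : ℝ) * (η₀ * 2 ^ L) = ∑ _v ∈ S₁, η₀ * (2 : ℝ) ^ L := by rw [Finset.sum_const, nsmul_eq_mul]
      _ ≤ ∑ v ∈ S₁, ((univ.filter fun u : Fin L → Bool => xorM X W u v = true).card : ℝ) :=
          Finset.sum_le_sum hper
      _ ≤ ∑ v : Fin L' → Bool, ((univ.filter fun u : Fin L → Bool => xorM X W u v = true).card : ℝ) :=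
          Finset.sum_le_sum_of_subset_of_nonneg (Finset.filter_subset _ _) fun _ _ _ => by positivity
      _ = (hw (xorM X W) : ℝ) := by rw [hw_eq_sum_cols]; push_cast; rfl
  -- (ii) even rows of `W + Y` are heavy
  set U₀ := univ.filter fun u : Fin L → Bool => prow u = 0 with hU₀
  have hrowcount : (U₀.card : ℝ) * (η₀ * 2 ^ L') ≤ (hw (xorM X W) : ℝ) + hw (xorM X Y) := by
    have hper : ∀ u ∈ U₀, η₀ * (2 : ℝ) ^ L' ≤
        ((univ.filter fun v : Fin L' → Bool => xorM X W u v = true).card : ℝ) +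
          ((univ.filter fun v : Fin L' → Bool => xorM X Y u v = true).card : ℝ) := by
      intro u hu
      have hu0 : prow u = 0 := (Finset.mem_filter.1 hu).2
      have hW0 : Wz u ∈ code L' d := (parity_zero_iff hψ0 hψ1 (hrowW u)).1 hu0
      have hYu : indZ (fun v => Y u v) + 1 ∈ code L' d :=
        indZ_fail_add_one_mem_code (2 * (c + wt u)) (hF₀ u).1 (hF₀ u).2
      have hsum : (indZ (fun v => W u v) + indZ (fun v => Y u v)) + 1 ∈ code L' d := by
        rw [add_assoc]
        exact Submodule.add_mem _ hW0 hYu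
      refine le_trans (odd_coset_heavy hn₀ hL'n hdL' hsum) ?_
      have hsub : (univ.filter fun v : Fin L' → Bool =>
            (indZ (fun v => W u v) + indZ (fun v => Y u v)) v = 1) ⊆
          (univ.filter fun v : Fin L' → Bool => xorM X W u v = true) ∪
            (univ.filter fun v : Fin L' → Bool => xorM X Y u v = true) := by
        intro v hv
        rw [mem_filter] at hv
        have hne := (indZ_add_eq_one_iff _ _ v).1 hv.2
        simp only [mem_union, mem_filter, mem_univ, true_and, xorM]
        revert hne
        cases X u v <;> cases W u v <;> cases Y u v <;> decide
      exact_mod_cast le_trans (card_le_card hsub) (card_union_le _ _)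
    calc (U₀.card : ℝ) * (η₀ * 2 ^ L') = ∑ _u ∈ U₀, η₀ * (2 : ℝ) ^ L' := by
          rw [Finset.sum_const, nsmul_eq_mul]
      _ ≤ ∑ u ∈ U₀, (((univ.filter fun v : Fin L' → Bool => xorM X W u v = true).card : ℝ) +
            ((univ.filter fun v : Fin L' → Bool => xorM X Y u v = true).card : ℝ)) :=
          Finset.sum_le_sum hper
      _ ≤ ∑ u : Fin L → Bool, (((univ.filter fun v : Fin L' → Bool => xorM X W u v = true).card : ℝ) +
            ((univ.filter fun v : Fin L' → Bool => xorM X Y u v = true).card : ℝ)) :=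
          Finset.sum_le_sum_of_subset_of_nonneg (Finset.filter_subset _ _) fun _ _ _ => by positivity
      _ = (hw (xorM X W) : ℝ) + hw (xorM X Y) := by
          rw [Finset.sum_add_distrib, hw_eq_sum_rows, hw_eq_sum_rows]; push_cast; rfl
  -- (iii) the parity `ε₀ = φ prow = ψ pcol`
  have hmain : (η₀ * 2 ^ L) * (η₀ * 2 ^ L') ≤ (hw (xorM X W) : ℝ) + hw (xorM X Y) := by
    have h2 : ∀ x : ZMod 2, x = 0 ∨ x = 1 := by decide
    rcases h2 (φ prow) with h0 | h1
    · -- `prow ∈ C`, so `prow + 1` is odd: many rows have parity 0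
      have hprow0 : prow ∈ code L d := (parity_zero_iff hφ0 hφ1 hprow_mem).1 h0
      have hodd : (prow + 1) + 1 ∈ code L d := by
        have : (prow + 1) + 1 = prow := by
          funext u; simp only [Pi.add_apply, Pi.one_apply]
          have : ∀ x : ZMod 2, x + 1 + 1 = x := by decide
          exact this _
        rw [this]; exact hprow0
      have hU : η₀ * (2 : ℝ) ^ L ≤ (U₀.card : ℝ) := by
        refine le_trans (odd_coset_heavy hn₀ hLn hdL hodd) ?_
        exact_mod_cast card_le_card fun u hu => by
          rw [mem_filter] at hu ⊢
          exact ⟨mem_univ _, (add_one_eq_one_iff _).1 hu.2⟩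
      calc (η₀ * 2 ^ L) * (η₀ * 2 ^ L') ≤ (U₀.card : ℝ) * (η₀ * 2 ^ L') :=
            mul_le_mul_of_nonneg_right hU (by positivity)
        _ ≤ _ := hrowcount
    · -- `ψ pcol = 1`, so `pcol` is odd: many columns have parity 1
      have hpc1 : ψ pcol = 1 := by rw [heps, h1]
      have hodd : pcol + 1 ∈ code L' d := (parity_one_iff hψ0 hψ1 hpcol_mem).1 hpc1
      have hS : η₀ * (2 : ℝ) ^ L' ≤ (S₁.card : ℝ) := by
        refine le_trans (odd_coset_heavy hn₀ hL'n hdL' hodd) ?_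
        exact_mod_cast card_le_card fun v hv => by
          rw [mem_filter] at hv ⊢
          exact ⟨mem_univ _, hv.2⟩
      calc (η₀ * 2 ^ L) * (η₀ * 2 ^ L') = (η₀ * 2 ^ L') * (η₀ * 2 ^ L) := by ring
        _ ≤ (S₁.card : ℝ) * (η₀ * 2 ^ L) := mul_le_mul_of_nonneg_right hS (by positivity)
        _ ≤ (hw (xorM X W) : ℝ) := hcolcount
        _ ≤ _ := le_add_of_nonneg_right (by positivity)
  -- assembling: `|Z| = 2^{L+L'} − crossWinCount`
  have hZ : (hw (xorM X Y) : ℝ) = (2 : ℝ) ^ (L + L') - crossWinCount c F₀ F₁ := by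
    have h := crossWinCount_add_agree c F₀ F₁
    rw [← hw_xorM_eq_agree c F₀ F₁] at h
    have h' : ((crossWinCount c F₀ F₁ : ℕ) : ℝ) + (hw (xorM X Y) : ℝ) = (2 : ℝ) ^ (L + L') := by
      rw [hX, hY]; exact_mod_cast h
    linarith
  have hpow : (2 : ℝ) ^ (L + L') = 2 ^ L * 2 ^ L' := pow_add _ _ _
  have hfin : η₀ ^ 2 * (2 : ℝ) ^ (L + L') ≤ (K + 1) * hw (xorM X Y) + η₀ ^ 2 / 2 * (2 : ℝ) ^ (L + L') := by
    have h1 : (η₀ * 2 ^ L) * (η₀ * 2 ^ L') = η₀ ^ 2 * (2 : ℝ) ^ (L + L') := by rw [hpow]; ring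
    nlinarith [hmain, hTR, h1]
  have hK1 : (0 : ℝ) < K + 1 := by linarith
  rw [hZ] at hfin
  have key : (crossWinCount c F₀ F₁ : ℝ) * (K + 1) ≤ (1 - η₀ ^ 2 / (2 * (K + 1))) * (2 : ℝ) ^ (L + L') * (K + 1) := by
    have : (1 - η₀ ^ 2 / (2 * (K + 1))) * (2 : ℝ) ^ (L + L') * (K + 1) =
        (K + 1) * (2 : ℝ) ^ (L + L') - η₀ ^ 2 / 2 * (2 : ℝ) ^ (L + L') := by
      field_simp
    rw [this]
    nlinarith [hfin]
  exact le_of_mul_le_mul_right key hK1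

end Summit.QuantumAdvantage.AdviceFreeQNC0
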